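import Summits.QuantumFields.YangMills.Theorems.UnitScaleTiltProp7SmoothUntwist
import Summits.QuantumFields.YangMills.Theorems.UnitScaleTiltProp7LemmaHCurvedFramesOfRegPr
import HarnessLib

/-!
# Route `UnitScaleTilt`, crux K1 «MinimiserStabilityRegPr» (stmt-QuantumFields-19200), route-R E′ path (α′), (E1) «pinned slice theorem» — its STARTING POINT (row R2 ∕ (F1′)):
# THE SMOOTH UNTWISTING IN k-UNIFORM CURRENCY — `ℓ·‖D‴ b‖ ≤ ℓs + (1+2s)(1+6σ)K₁` and `ℓ²·‖divB 𝒰 D‴ x‖ ≤ ℓ²·‖divB 𝒰 A₀ x‖ + d·(K₂ + 9K₁² + 36σK₂ + (6 + 4(1+6σ))·ℓs·K₁)`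
# with `K₁ = (6 + 2c₀)·2σ`, `K₂ = (2(c₁ + 2c₀²) + 24c₀ + 24)·2σ` depending ONLY on the twist's centre sup `σ` and the frame constants `ℓa₀ ≤ c₀`, `ℓ²a₁ ≤ c₁`

Cell `ym3-torus`, width seat `ym-ust-19200-w1` (gen 12); LOCATE `LOCATE-F1PRIME-SMOOTH-UNTWIST-w1g12.md` (19200 evidence n = 55), file (U4) — the `q`-currency reading of ✓
`Prop7SmoothUntwist.exists_smoothUntwistedChart_T3` (U3).  THEOREMS ONLY (0 `def`, 0 `sorry`); `--supports stmt-QuantumFields-19200`, count-neutral.  YM₃ on T³ is a ladder rung (R3),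
not the Clay problem; nothing here claims a stub, the crux, d = 4 or the mass gap; (E1) is NOT closed by this file.

WHY.  (E1)'s data row is `q D ≤ s_*` with `q = max(ℓ·sup‖·‖, ℓ²·sup‖divB 𝒰 ·‖)` (✓ `Prop7ExactCorrectorContractionGauge`, ✓ `Prop7LinearCorrectorBound`).  (U3) states the two rows
of the smooth untwisted chart with the frame rows `a₀, a₁` raw; here they are read with the k-UNIFORM frame constants of ✓ `Prop7LemmaHCurvedFramesOfRegPr.exists_frames_T3_of_regPr`
(`ℓa₀ ≤ c₀`, `ℓ²a₁ ≤ c₁`, `c₀ = c₁ = C′e^{C′}`, `C′ = c35·L·L^{a′}·α₀`) and multiplied through by `ℓ`, `ℓ²`: every constant on the right is a polynomial in `σ, c₀, c₁, ℓs` — no `ℓ`,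
no `K − n`, no volume.  With print's rows (`ℓs = s₀` (1.36)₁, `ℓ²‖divB 𝒰 A₀‖ ≤ s₁′` (1.36)₂, `σ = 16dB₁(α₀+α₁)` (1.72)) this is `q D‴ ≤ max(s₀ + O(σ), s₁′ + O(σ))`.

WHAT IS PROVED (ns `…Theorems.Prop7SmoothUntwistKUniform`).
* `frame_rows_scaled` — `(6∕ℓ + 2a₀)·2σ ≤ K₁∕ℓ` and `(2(a₁+2a₀²) + 4a₀(6∕ℓ) + 24∕ℓ²)·2σ ≤ K₂∕ℓ²` from `ℓa₀ ≤ c₀`, `ℓ²a₁ ≤ c₁`.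
* ★★★ `exists_smoothUntwistedChart_kUniform_T3` — (U3) with `B₁ := K₁∕ℓ`, `B₂ := K₂∕ℓ²`, conclusions multiplied by `ℓ` and `ℓ²`.
* ★★★ `exists_smoothUntwistedChart_of_regPr_T3` — the frames DISCHARGED at the member of record by ✓ `Prop7LemmaHCurvedFramesOfRegPr.exists_frames_T3_of_regPr` (`RegPr F n K α₀ W`,
  `(L·L^{a′})α₀ ≤ a₅`): `c₀ = c₁ = C′e^{C′}`, `C′ = c35·(L·L^{a′})·α₀` — only print's rows (`s`, `σ`, `divB 𝒰 A₀`) and `RegPr` remain.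
HONEST SCOPE.  Arithmetic over (U3); displayed: frames (bi-contractive, normalised, window rows `a₀ a₁` with `ℓa₀ ≤ c₀`, `ℓ²a₁ ≤ c₁`), `σ`, `s`; `A₀`'s divergence stays on the right.

References: T. Bałaban, CMP 99 (1985) 75–102 [Balaban1985RegularSpaces] ((1.36) p.82, (1.72) p.88); CMP 99 (1985) 389–434 [Balaban1985BackgroundPropagators] ((3.35) p.396, (3.8) p.392);
CMP 102 (1985) 277–309 [Balaban1985Variational] ((15) p.280).
-/

set_option autoImplicit false

noncomputable section

open scoped BigOperators Matrix.Norms.L2Operator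

namespace Summit.QuantumFields.YangMills.Theorems.Prop7SmoothUntwistKUniform

open Literature.MathematicalPhysics.QuantumFieldTheory.Balaban1983to89
open Literature.MathematicalPhysics.QuantumFieldTheory.Balaban1983to89.T3ContinuumYM3Torus
open Literature.MathematicalPhysics.QuantumFieldTheory.Balaban1983to89.T3PrintedRegularMinimiser (regFibrePr)
open Literature.MathematicalPhysics.QuantumFieldTheory.Balaban1983to89.T3SectALandauChart (emb15)
open T4Continuum
open B9Eq39Adjoint (divB)
open B9TorusCalculus (torusT)
open B10Eq27TorusAxialLog (unitsField toUField)
open B5Eq118OneStroke (iterBlockOf)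
open B15DeterminingSets (embIter)
open Summit.QuantumFields.YangMills.Theorems.Prop7TPrint (expHermField)
open Summit.QuantumFields.YangMills.Theorems.Prop7SmoothUntwist (exists_smoothUntwistedChart_T3)
open Literature.MathematicalPhysics.QuantumFieldTheory.Balaban1983to89.T3PrintedRegularMinimiser (RegPr)
open Literature.MathematicalPhysics.QuantumFieldTheory.Balaban1983to89.B6GlobalChartV1 (PV)
open Summit.QuantumFields.YangMills.Theorems.Prop7SectET3Members (hd3)
open Summit.QuantumFields.YangMills.Theorems.Prop7LemmaHCurvedFramesOfRegPr (exists_frames_T3_of_regPr)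

/-- **THE FRAME ROWS IN k-UNIFORM CURRENCY**: `ℓa₀ ≤ c₀`, `ℓ²a₁ ≤ c₁`, `ℓ ≥ 1` give `(6∕ℓ + 2a₀)·M ≤ ((6 + 2c₀)M)∕ℓ` and
`(2(a₁ + 2a₀²) + 4a₀(6∕ℓ) + 24∕ℓ²)·M ≤ ((2(c₁ + 2c₀²) + 24c₀ + 24)M)∕ℓ²` for `M ≥ 0`. [cite: Balaban1985BackgroundPropagators, (3.35) p.396] -/
theorem frame_rows_scaled {ℓ a₀ a₁ c₀ c₁ M : ℝ} (hℓ : 1 ≤ ℓ) (ha₀ : 0 ≤ a₀) (hM : 0 ≤ M) (hc₀ : ℓ * a₀ ≤ c₀) (hc₁ : ℓ ^ 2 * a₁ ≤ c₁) :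
    (6 / ℓ + 2 * a₀) * M ≤ (6 + 2 * c₀) * M / ℓ
    ∧ (2 * (a₁ + 2 * a₀ ^ 2) + 4 * a₀ * (6 / ℓ) + 24 / ℓ ^ 2) * M ≤ (2 * (c₁ + 2 * c₀ ^ 2) + 24 * c₀ + 24) * M / ℓ ^ 2 := by
  have hℓ0 : 0 < ℓ := by linarith
  have hℓ2 : 0 < ℓ ^ 2 := by positivity
  have ha0' : a₀ ≤ c₀ / ℓ := by rw [le_div_iff₀ hℓ0]; linarith
  have ha1' : a₁ ≤ c₁ / ℓ ^ 2 := by rw [le_div_iff₀ hℓ2]; linarith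
  have hc0nn : 0 ≤ c₀ := le_trans (by positivity) hc₀
  refine ⟨?_, ?_⟩
  · rw [le_div_iff₀ hℓ0]
    have : (6 / ℓ + 2 * a₀) * M * ℓ = (6 + 2 * (ℓ * a₀)) * M := by field_simp
    rw [this]
    exact mul_le_mul_of_nonneg_right (by linarith) hM
  · rw [le_div_iff₀ hℓ2]
    have e : (2 * (a₁ + 2 * a₀ ^ 2) + 4 * a₀ * (6 / ℓ) + 24 / ℓ ^ 2) * M * ℓ ^ 2
        = (2 * (ℓ ^ 2 * a₁ + 2 * (ℓ * a₀) ^ 2) + 24 * (ℓ * a₀) + 24) * M := by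
      field_simp
      ring
    rw [e]
    refine mul_le_mul_of_nonneg_right ?_ hM
    have h1 : (ℓ * a₀) ^ 2 ≤ c₀ ^ 2 := pow_le_pow_left₀ (by positivity) hc₀ 2
    have h2 : ℓ * a₀ ≤ c₀ := hc₀
    nlinarith [h1, h2, hc₁]

/-- ★★★ **THE SMOOTH UNTWISTED CHART, k-UNIFORM CURRENCY.**  Hypotheses of ✓ `exists_smoothUntwistedChart_T3` with the frame rows read through `ℓa₀ ≤ c₀`, `ℓ²a₁ ≤ c₁`
(`ℓ = L^{K−n}`) and the σ-window `(6 + 2c₀)·2σ ≤ 1∕256`; with `K₁ := (6 + 2c₀)·2σ`, `K₂ := (2(c₁ + 2c₀²) + 24c₀ + 24)·2σ`: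
`∃ D‴` Hermitian-traceless, `ℓ·‖D‴ b‖ ≤ ℓ·s + (1+2s)(1+6σ)K₁`, `ℓ²·‖divB 𝒰 D‴ x‖ ≤ ℓ²·‖divB 𝒰 A₀ x‖ + d·(K₂ + 9K₁² + 36σK₂) + d·(6K₁(ℓs) + 4(ℓs)(1+6σ)K₁)`, same action as
`X^u`, on the fibre `(6)(e) ∩ 𝔅_k(V)`. [cite: Balaban1985RegularSpaces, (1.36) p.82, (1.72) p.88; Balaban1985BackgroundPropagators, (3.35) p.396, (3.8) p.392; Balaban1985Variational, (15) p.280] -/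
theorem exists_smoothUntwistedChart_kUniform_T3 (F : T3Family) {n K : ℕ} (h : n ≤ K) (hk1 : 1 ≤ K - n) {e s σ a₀ a₁ c₀ c₁ : ℝ} (he : 0 ≤ e)
    {V : GaugeField (F.P n) 0 (Matrix.specialUnitaryGroup (Fin 2) ℂ)} (W : GaugeField (F.P K) 0 (Matrix.specialUnitaryGroup (Fin 2) ℂ))
    (A₀ : PBond (F.P K) 0 → Matrix (Fin 2) (Fin 2) ℂ) (hA0 : ∀ b, (A₀ b).IsHermitian ∧ Matrix.trace (A₀ b) = 0) (hs : ∀ b, ‖A₀ b‖ ≤ s) (hs0 : s ≤ 1 / 64)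
    (u : GaugeTransf (F.P K) 0 (Matrix.specialUnitaryGroup (Fin 2) ℂ)) (hXu : GaugeField.gaugeAct u (emb15 W (expHermField A₀)) ∈ regFibrePr F n K h e V)
    (hσ : ∀ y : Site (F.P K) (K - n), dist1 (u (embIter (K - n) y)) ≤ σ) (hσ0 : σ ≤ 1 / 1024) (hσc : (6 + 2 * c₀) * (2 * σ) ≤ 1 / 256)
    (Fr : Site (F.P K) (K - n) → Site (F.P K) 0 → (Matrix (Fin 2) (Fin 2) ℂ)ˣ)
    (hFr : ∀ y z, ‖(Fr y z : Matrix (Fin 2) (Fin 2) ℂ)‖ ≤ 1 ∧ ‖(((Fr y z)⁻¹ : (Matrix (Fin 2) (Fin 2) ℂ)ˣ) : Matrix (Fin 2) (Fin 2) ℂ)‖ ≤ 1) (hFr1 : ∀ y, Fr y (embIter (K - n) y) = 1)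
    (ha₀ : 0 ≤ a₀) (ha₁ : 0 ≤ a₁) (hc₀ : ((((F.P K).L ^ (K - n) : ℕ)) : ℝ) * a₀ ≤ c₀) (hc₁ : ((((F.P K).L ^ (K - n) : ℕ)) : ℝ) ^ 2 * a₁ ≤ c₁)
    (hA : ∀ (y : Site (F.P K) (K - n)) (z : Site (F.P K) 0), (∀ ν : Fin (F.P K).d, (y ν = (iterBlockOf (K - n) (fun κ => z κ - (((((F.P K).L ^ (K - n) - 1) / 2 : ℕ)) : ZMod ((F.P K).sitesPerDir 0)))) ν - 1 ∨ y ν = (iterBlockOf (K - n) (fun κ => z κ - (((((F.P K).L ^ (K - n) - 1) / 2 : ℕ)) : ZMod ((F.P K).sitesPerDir 0)))) ν ∨ y ν = (iterBlockOf (K - n) (fun κ => z κ - (((((F.P K).L ^ (K - n) - 1) / 2 : ℕ)) : ZMod ((F.P K).sitesPerDir 0)))) ν + 1 ∨ y ν = (iterBlockOf (K - n) (fun κ => z κ - (((((F.P K).L ^ (K - n) - 1) / 2 : ℕ)) : ZMod ((F.P K).sitesPerDir 0)))) ν + 2)) → ∀ μ : Fin (F.P K).d,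
      ‖(((Fr y z)⁻¹ * unitsField (toUField W) ⟨z, μ⟩ * Fr y (torusT (F.P K) 0 μ z) : (Matrix (Fin 2) (Fin 2) ℂ)ˣ) : Matrix (Fin 2) (Fin 2) ℂ) - 1‖ ≤ a₀
      ∧ ‖(((Fr y ((torusT (F.P K) 0 μ).symm z))⁻¹ * unitsField (toUField W) ⟨(torusT (F.P K) 0 μ).symm z, μ⟩ * Fr y z : (Matrix (Fin 2) (Fin 2) ℂ)ˣ) : Matrix (Fin 2) (Fin 2) ℂ) - 1‖ ≤ a₀
      ∧ ‖(((Fr y z)⁻¹ * unitsField (toUField W) ⟨z, μ⟩ * Fr y (torusT (F.P K) 0 μ z) : (Matrix (Fin 2) (Fin 2) ℂ)ˣ) : Matrix (Fin 2) (Fin 2) ℂ)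
          - (((Fr y ((torusT (F.P K) 0 μ).symm z))⁻¹ * unitsField (toUField W) ⟨(torusT (F.P K) 0 μ).symm z, μ⟩ * Fr y z : (Matrix (Fin 2) (Fin 2) ℂ)ˣ) : Matrix (Fin 2) (Fin 2) ℂ)‖ ≤ a₁) :
    ∃ D : PBond (F.P K) 0 → Matrix (Fin 2) (Fin 2) ℂ,
      (∀ b, (D b).IsHermitian ∧ Matrix.trace (D b) = 0) ∧
      (∀ b, ((((F.P K).L ^ (K - n) : ℕ)) : ℝ) * ‖D b‖ ≤ ((((F.P K).L ^ (K - n) : ℕ)) : ℝ) * s + (1 + 2 * s) * ((1 + 6 * σ) * ((6 + 2 * c₀) * (2 * σ)))) ∧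
      (∀ x, ((((F.P K).L ^ (K - n) : ℕ)) : ℝ) ^ 2 * ‖divB (torusT (F.P K) 0) (fun κ z => unitsField (toUField W) ⟨z, κ⟩) (fun μ z => D ⟨z, μ⟩) x‖
          ≤ ((((F.P K).L ^ (K - n) : ℕ)) : ℝ) ^ 2 * ‖divB (torusT (F.P K) 0) (fun κ z => unitsField (toUField W) ⟨z, κ⟩) (fun μ z => A₀ ⟨z, μ⟩) x‖
            + ((F.P K).d : ℝ) * ((2 * (c₁ + 2 * c₀ ^ 2) + 24 * c₀ + 24) * (2 * σ) + 9 * ((6 + 2 * c₀) * (2 * σ)) ^ 2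
                + 36 * σ * ((2 * (c₁ + 2 * c₀ ^ 2) + 24 * c₀ + 24) * (2 * σ)))
            + ((F.P K).d : ℝ) * (6 * ((6 + 2 * c₀) * (2 * σ)) * (((((F.P K).L ^ (K - n) : ℕ)) : ℝ) * s) + 4 * (((((F.P K).L ^ (K - n) : ℕ)) : ℝ) * s) * ((1 + 6 * σ) * ((6 + 2 * c₀) * (2 * σ))))) ∧
      wilsonAction4 (GaugeField.gaugeAct u (emb15 W (expHermField A₀))) = wilsonAction4 (emb15 W (expHermField D)) ∧
      emb15 W (expHermField D) ∈ regFibrePr F n K h e V := by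
  have hL2 : 2 ≤ (F.P K).L := by have := (F.P K).hL.2; omega
  have hℓ2 : 2 ≤ (F.P K).L ^ (K - n) := hL2.trans (Nat.le_self_pow (by omega) _)
  have hℓ : (1 : ℝ) ≤ ((((F.P K).L ^ (K - n) : ℕ)) : ℝ) := by exact_mod_cast (le_trans (by norm_num) hℓ2)
  have hℓ0 : (0 : ℝ) < ((((F.P K).L ^ (K - n) : ℕ)) : ℝ) := by linarith
  have hσnn : 0 ≤ σ := (GaugeGroup.dist1_nonneg _).trans (hσ (Classical.arbitrary _))
  have hM : 0 ≤ 2 * σ := by positivity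
  obtain ⟨hK1, hK2⟩ := frame_rows_scaled (M := 2 * σ) hℓ ha₀ hM hc₀ hc₁
  have hB₁' : (6 + 2 * c₀) * (2 * σ) / ((((F.P K).L ^ (K - n) : ℕ)) : ℝ) ≤ 1 / 256 := by
    rw [div_le_iff₀ hℓ0]
    have hKnn : 0 ≤ (6 + 2 * c₀) * (2 * σ) := by
      have hc0nn : 0 ≤ c₀ := le_trans (by positivity) hc₀
      positivity
    nlinarith
  obtain ⟨D, hD1, hD2, hD3, hD4, hD5⟩ := exists_smoothUntwistedChart_T3 F h hk1 he W A₀ hA0 hs hs0 u hXu hσ hσ0 Fr hFr hFr1 ha₀ ha₁ hA hK1 hB₁' hK2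
  refine ⟨D, hD1, fun b => ?_, fun x => ?_, hD4, hD5⟩
  · have h1 := mul_le_mul_of_nonneg_left (hD2 b) hℓ0.le
    have e : ((((F.P K).L ^ (K - n) : ℕ)) : ℝ) * (s + (1 + 2 * s) * ((1 + 6 * σ) * ((6 + 2 * c₀) * (2 * σ) / ((((F.P K).L ^ (K - n) : ℕ)) : ℝ))))
        = ((((F.P K).L ^ (K - n) : ℕ)) : ℝ) * s + (1 + 2 * s) * ((1 + 6 * σ) * ((6 + 2 * c₀) * (2 * σ))) := by
      field_simp
    linarith [h1, e.le]
  · have h1 := mul_le_mul_of_nonneg_left (hD3 x) (le_of_lt (by positivity : (0 : ℝ) < ((((F.P K).L ^ (K - n) : ℕ)) : ℝ) ^ 2))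
    have hℓ20 : (((((F.P K).L ^ (K - n) : ℕ)) : ℝ)) ^ 2 ≠ 0 := by positivity
    have e : ((((F.P K).L ^ (K - n) : ℕ)) : ℝ) ^ 2 * (‖divB (torusT (F.P K) 0) (fun κ z => unitsField (toUField W) ⟨z, κ⟩) (fun μ z => A₀ ⟨z, μ⟩) x‖
          + ((F.P K).d : ℝ) * ((2 * (c₁ + 2 * c₀ ^ 2) + 24 * c₀ + 24) * (2 * σ) / ((((F.P K).L ^ (K - n) : ℕ)) : ℝ) ^ 2 + 9 * ((6 + 2 * c₀) * (2 * σ) / ((((F.P K).L ^ (K - n) : ℕ)) : ℝ)) ^ 2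
              + 36 * σ * ((2 * (c₁ + 2 * c₀ ^ 2) + 24 * c₀ + 24) * (2 * σ) / ((((F.P K).L ^ (K - n) : ℕ)) : ℝ) ^ 2))
          + ((F.P K).d : ℝ) * (6 * ((6 + 2 * c₀) * (2 * σ) / ((((F.P K).L ^ (K - n) : ℕ)) : ℝ)) * s + 4 * s * ((1 + 6 * σ) * ((6 + 2 * c₀) * (2 * σ) / ((((F.P K).L ^ (K - n) : ℕ)) : ℝ)))))
        = ((((F.P K).L ^ (K - n) : ℕ)) : ℝ) ^ 2 * ‖divB (torusT (F.P K) 0) (fun κ z => unitsField (toUField W) ⟨z, κ⟩) (fun μ z => A₀ ⟨z, μ⟩) x‖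
          + ((F.P K).d : ℝ) * ((2 * (c₁ + 2 * c₀ ^ 2) + 24 * c₀ + 24) * (2 * σ) + 9 * ((6 + 2 * c₀) * (2 * σ)) ^ 2
              + 36 * σ * ((2 * (c₁ + 2 * c₀ ^ 2) + 24 * c₀ + 24) * (2 * σ)))
          + ((F.P K).d : ℝ) * (6 * ((6 + 2 * c₀) * (2 * σ)) * (((((F.P K).L ^ (K - n) : ℕ)) : ℝ) * s) + 4 * (((((F.P K).L ^ (K - n) : ℕ)) : ℝ) * s) * ((1 + 6 * σ) * ((6 + 2 * c₀) * (2 * σ)))) := by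
      field_simp
    linarith [h1, e.le, e.ge]


/-! ## §3 The frames discharged at the member of record -/

section Member

variable {ℓ : ℕ} {hL : Odd (ℓ + 1) ∧ 1 < ℓ + 1}

/-- ★★★ **THE SMOOTH UNTWISTED CHART AT THE MEMBER, FRAMES DISCHARGED BY `RegPr`.**  Family `⟨L, hL, m, hm⟩`, `L = ℓ + 1 ≥ 5`; member bookkeeping `1 ≤ K − n`, `a′ + 3 ≤ m + n`,
`8 ≤ L^{a′}`, `2L² ≤ R` (as in ✓ `exists_frames_T3_of_regPr`); print's regime `(L·L^{a′})·α₀ ≤ a₅`, `RegPr F n K α₀ W`.  With `C′ := c35·(L·L^{a′})·α₀`, `c₀ := C′e^{C′}`,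
`K₁ := (6 + 2c₀)·2σ`, `K₂ := (2(c₀ + 2c₀²) + 24c₀ + 24)·2σ`, and the σ-window `K₁ ≤ 1∕256`: the conclusions of `exists_smoothUntwistedChart_kUniform_T3` with `c₁ := c₀` — only `s`, `σ`,
`divB 𝒰 A₀` remain displayed.  [cite: Balaban1985RegularSpaces, (1.33) p.82, (1.36) p.82, (1.72) p.88, Prop. 6 p.99; Balaban1985BackgroundPropagators, (3.35) p.396; Balaban1985Variational, (15) p.280] -/
theorem exists_smoothUntwistedChart_of_regPr_T3 (hℓ4 : 4 ≤ ℓ) :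
    ∃ c35 a₅ : ℝ, 0 < c35 ∧ 0 < a₅ ∧
      ∀ (hℓ : 4 ≤ ℓ) (m : ℕ) (hm : 1 ≤ m) (n K a' R : ℕ) (hk1 : 1 ≤ K - n) (hsize : a' + 3 ≤ m + n) (hM8 : 8 ≤ (ℓ + 1) ^ a')
        (hR2 : 2 * (ℓ + 1) ^ 2 ≤ R) (α₀ : ℝ), 0 < α₀ → ((ℓ + 1 : ℕ) : ℝ) * (((ℓ + 1) ^ a' : ℕ) : ℝ) * α₀ ≤ a₅ →
        ∀ (W : GaugeField ((⟨ℓ + 1, hL, m, hm⟩ : T3Family).P K) 0 (Matrix.specialUnitaryGroup (Fin 2) ℂ)), RegPr (⟨ℓ + 1, hL, m, hm⟩ : T3Family) n K α₀ W →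
        ∀ (h : n ≤ K) {e s σ : ℝ}, 0 ≤ e → ∀ {V : GaugeField ((⟨ℓ + 1, hL, m, hm⟩ : T3Family).P n) 0 (Matrix.specialUnitaryGroup (Fin 2) ℂ)}
          (A₀ : PBond ((⟨ℓ + 1, hL, m, hm⟩ : T3Family).P K) 0 → Matrix (Fin 2) (Fin 2) ℂ), (∀ b, (A₀ b).IsHermitian ∧ Matrix.trace (A₀ b) = 0) → (∀ b, ‖A₀ b‖ ≤ s) → s ≤ 1 / 64 →
        ∀ (u : GaugeTransf ((⟨ℓ + 1, hL, m, hm⟩ : T3Family).P K) 0 (Matrix.specialUnitaryGroup (Fin 2) ℂ)),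
          GaugeField.gaugeAct u (emb15 W (expHermField A₀)) ∈ regFibrePr (⟨ℓ + 1, hL, m, hm⟩ : T3Family) n K h e V →
          (∀ y : Site ((⟨ℓ + 1, hL, m, hm⟩ : T3Family).P K) (K - n), dist1 (u (embIter (K - n) y)) ≤ σ) → σ ≤ 1 / 1024 → ((6 + 2 * ((c35 * (((ℓ + 1 : ℕ) : ℝ) * (((ℓ + 1) ^ a' : ℕ) : ℝ)) * α₀) * Real.exp (c35 * (((ℓ + 1 : ℕ) : ℝ) * (((ℓ + 1) ^ a' : ℕ) : ℝ)) * α₀))) * (2 * σ)) ≤ 1 / 256 →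
        ∃ D : PBond ((⟨ℓ + 1, hL, m, hm⟩ : T3Family).P K) 0 → Matrix (Fin 2) (Fin 2) ℂ,
          (∀ b, (D b).IsHermitian ∧ Matrix.trace (D b) = 0) ∧
          (∀ b, ((((ℓ + 1) ^ (K - n) : ℕ)) : ℝ) * ‖D b‖ ≤ ((((ℓ + 1) ^ (K - n) : ℕ)) : ℝ) * s + (1 + 2 * s) * ((1 + 6 * σ) * ((6 + 2 * ((c35 * (((ℓ + 1 : ℕ) : ℝ) * (((ℓ + 1) ^ a' : ℕ) : ℝ)) * α₀) * Real.exp (c35 * (((ℓ + 1 : ℕ) : ℝ) * (((ℓ + 1) ^ a' : ℕ) : ℝ)) * α₀))) * (2 * σ)))) ∧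
          (∀ x, ((((ℓ + 1) ^ (K - n) : ℕ)) : ℝ) ^ 2 * ‖divB (torusT ((⟨ℓ + 1, hL, m, hm⟩ : T3Family).P K) 0) (fun κ z => unitsField (toUField W) ⟨z, κ⟩) (fun μ z => D ⟨z, μ⟩) x‖
              ≤ ((((ℓ + 1) ^ (K - n) : ℕ)) : ℝ) ^ 2 * ‖divB (torusT ((⟨ℓ + 1, hL, m, hm⟩ : T3Family).P K) 0) (fun κ z => unitsField (toUField W) ⟨z, κ⟩) (fun μ z => A₀ ⟨z, μ⟩) x‖
                + (3 : ℝ) * (((2 * (((c35 * (((ℓ + 1 : ℕ) : ℝ) * (((ℓ + 1) ^ a' : ℕ) : ℝ)) * α₀) * Real.exp (c35 * (((ℓ + 1 : ℕ) : ℝ) * (((ℓ + 1) ^ a' : ℕ) : ℝ)) * α₀)) + 2 * ((c35 * (((ℓ + 1 : ℕ) : ℝ) * (((ℓ + 1) ^ a' : ℕ) : ℝ)) * α₀) * Real.exp (c35 * (((ℓ + 1 : ℕ) : ℝ) * (((ℓ + 1) ^ a' : ℕ) : ℝ)) * α₀)) ^ 2) + 24 * ((c35 * (((ℓ + 1 :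 ℕ) : ℝ) * (((ℓ + 1) ^ a' : ℕ) : ℝ)) * α₀) * Real.exp (c35 * (((ℓ + 1 : ℕ) : ℝ) * (((ℓ + 1) ^ a' : ℕ) : ℝ)) * α₀)) + 24) * (2 * σ)) + 9 * ((6 + 2 * ((c35 * (((ℓ + 1 : ℕ) : ℝ) * (((ℓ + 1) ^ a' : ℕ) : ℝ)) * α₀) * Real.exp (c35 * (((ℓ + 1 : ℕ) : ℝ) * (((ℓ + 1) ^ a' : ℕ) : ℝ)) * α₀))) * (2 * σ)) ^ 2 + 36 * σ * ((2 * (((c35 * (((ℓ + 1 : ℕ) : ℝ) * (((ℓ + 1) ^ a' : ℕ) : ℝ)) * α₀) * Real.exp (c35 * (((ℓ + 1 : ℕ) : ℝ) * (((ℓ + 1) ^ a' : ℕ) : ℝ)) * α₀)) + 2 * ((c35 * (((ℓ + 1 : ℕ) : ℝ) * (((ℓ + 1) ^ a' : ℕ) : ℝ)) * α₀) * Real.exp (c35 * (((ℓ + 1 : ℕ) : ℝ) * (((ℓ + 1) ^ a' : ℕ) : ℝ)) * α₀)) ^ 2) + 24 * ((c35 * (((ℓ + 1 : ℕ) : ℝ)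 * (((ℓ + 1) ^ a' : ℕ) : ℝ)) * α₀) * Real.exp (c35 * (((ℓ + 1 : ℕ) : ℝ) * (((ℓ + 1) ^ a' : ℕ) : ℝ)) * α₀)) + 24) * (2 * σ)))
                + (3 : ℝ) * (6 * ((6 + 2 * ((c35 * (((ℓ + 1 : ℕ) : ℝ) * (((ℓ + 1) ^ a' : ℕ) : ℝ)) * α₀) * Real.exp (c35 * (((ℓ + 1 : ℕ) : ℝ) * (((ℓ + 1) ^ a' : ℕ) : ℝ)) * α₀))) * (2 * σ)) * (((((ℓ + 1) ^ (K - n) : ℕ)) : ℝ) * s) + 4 * (((((ℓ + 1) ^ (K - n) : ℕ)) : ℝ) * s) * ((1 + 6 * σ) * ((6 + 2 * ((c35 * (((ℓ + 1 : ℕ) : ℝ) * (((ℓ + 1) ^ a' : ℕ) : ℝ)) * α₀) * Real.exp (c35 * (((ℓ + 1 : ℕ) : ℝ) * (((ℓ + 1) ^ a' : ℕ) : ℝ)) * α₀))) * (2 * σ))))) ∧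
          wilsonAction4 (GaugeField.gaugeAct u (emb15 W (expHermField A₀))) = wilsonAction4 (emb15 W (expHermField D)) ∧
          emb15 W (expHermField D) ∈ regFibrePr (⟨ℓ + 1, hL, m, hm⟩ : T3Family) n K h e V := by
  obtain ⟨c35, a₅, hc35, ha₅, hfr⟩ := exists_frames_T3_of_regPr (hL := hL) hℓ4
  refine ⟨c35, a₅, hc35, ha₅, fun hℓ m hm n K a' R hk1 hsize hM8 hR2 α₀ hα₀ hsmall W hW h e s σ he V A₀ hA0 hs hs0 u hXu hσ hσ0 hσc => ?_⟩
  obtain ⟨Fr, hFr, hFr1, hA⟩ := hfr hℓ m hm n K a' R hk1 hsize hM8 hR2 α₀ hα₀ hsmall W hW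
  -- the k-uniform frame constants
  have hLpos : (0 : ℝ) < ((((ℓ + 1) ^ (K - n) : ℕ)) : ℝ) := by positivity
  have hL1 : (1 : ℝ) ≤ ((((ℓ + 1) ^ (K - n) : ℕ)) : ℝ) := by exact_mod_cast Nat.one_le_pow _ _ (by omega)
  have hC0 : 0 ≤ (c35 * (((ℓ + 1 : ℕ) : ℝ) * (((ℓ + 1) ^ a' : ℕ) : ℝ)) * α₀) := by positivity
  have hpow : ((((ℓ + 1) ^ (K - n) : ℕ)) : ℝ) = (((ℓ + 1 : ℕ) : ℝ)) ^ (K - n) := by push_cast; ring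
  have hη1 : ((((ℓ + 1 : ℕ) : ℝ)) ^ (K - n))⁻¹ ≤ 1 := by rw [← hpow]; exact inv_le_one_of_one_le₀ hL1
  have hη0 : 0 ≤ ((((ℓ + 1 : ℕ) : ℝ)) ^ (K - n))⁻¹ := by rw [← hpow]; positivity
  have hexp : Real.exp (((((ℓ + 1 : ℕ) : ℝ)) ^ (K - n))⁻¹ * (c35 * (((ℓ + 1 : ℕ) : ℝ) * (((ℓ + 1) ^ a' : ℕ) : ℝ)) * α₀)) ≤ Real.exp (c35 * (((ℓ + 1 : ℕ) : ℝ) * (((ℓ + 1) ^ a' : ℕ) : ℝ)) * α₀) :=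
    Real.exp_le_exp.2 (by nlinarith)
  have hc₀ : ((((ℓ + 1) ^ (K - n) : ℕ)) : ℝ) * (((((ℓ + 1 : ℕ) : ℝ)) ^ (K - n))⁻¹ * (c35 * (((ℓ + 1 : ℕ) : ℝ) * (((ℓ + 1) ^ a' : ℕ) : ℝ)) * α₀) * Real.exp (((((ℓ + 1 : ℕ) : ℝ)) ^ (K - n))⁻¹ * (c35 * (((ℓ + 1 : ℕ) : ℝ) * (((ℓ + 1) ^ a' : ℕ) : ℝ)) * α₀))) ≤ ((c35 * (((ℓ + 1 : ℕ) : ℝ) * (((ℓ + 1) ^ a' : ℕ) : ℝ)) * α₀) * Real.exp (c35 * (((ℓ + 1 : ℕ) : ℝ) * (((ℓ + 1) ^ a' : ℕ) : ℝ)) * α₀)) := by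
    rw [hpow, ← mul_assoc, ← mul_assoc, mul_inv_cancel₀ (by rw [← hpow]; exact hLpos.ne'), one_mul]
    exact mul_le_mul_of_nonneg_left hexp hC0
  have hc₁ : ((((ℓ + 1) ^ (K - n) : ℕ)) : ℝ) ^ 2 * (((((ℓ + 1 : ℕ) : ℝ)) ^ (K - n))⁻¹ * (((((ℓ + 1 : ℕ) : ℝ)) ^ (K - n))⁻¹ * (c35 * (((ℓ + 1 : ℕ) : ℝ) * (((ℓ + 1) ^ a' : ℕ) : ℝ)) * α₀)) * Real.exp (((((ℓ + 1 : ℕ) : ℝ)) ^ (K - n))⁻¹ * (c35 * (((ℓ + 1 : ℕ) : ℝ) * (((ℓ + 1) ^ a' : ℕ) : ℝ)) * α₀))) ≤ ((c35 * (((ℓ + 1 : ℕ) : ℝ) * (((ℓ + 1) ^ a' : ℕ) : ℝ)) * α₀) * Real.exp (c35 * (((ℓ + 1 : ℕ) : ℝ) * (((ℓ + 1) ^ a' : ℕ) : ℝ)) * α₀)) := by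
    have hne : (((ℓ + 1 : ℕ) : ℝ)) ^ (K - n) ≠ 0 := by rw [← hpow]; exact hLpos.ne'
    have e1 : ((((ℓ + 1) ^ (K - n) : ℕ)) : ℝ) ^ 2 * (((((ℓ + 1 : ℕ) : ℝ)) ^ (K - n))⁻¹ * (((((ℓ + 1 : ℕ) : ℝ)) ^ (K - n))⁻¹ * (c35 * (((ℓ + 1 : ℕ) : ℝ) * (((ℓ + 1) ^ a' : ℕ) : ℝ)) * α₀)) * Real.exp (((((ℓ + 1 : ℕ) : ℝ)) ^ (K - n))⁻¹ * (c35 * (((ℓ + 1 : ℕ) : ℝ) * (((ℓ + 1) ^ a' : ℕ) : ℝ)) * α₀)))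
        = (c35 * (((ℓ + 1 : ℕ) : ℝ) * (((ℓ + 1) ^ a' : ℕ) : ℝ)) * α₀) * Real.exp (((((ℓ + 1 : ℕ) : ℝ)) ^ (K - n))⁻¹ * (c35 * (((ℓ + 1 : ℕ) : ℝ) * (((ℓ + 1) ^ a' : ℕ) : ℝ)) * α₀)) := by
      rw [hpow]; field_simp
    rw [e1]
    exact mul_le_mul_of_nonneg_left hexp hC0
  have ha₀ : 0 ≤ ((((ℓ + 1 : ℕ) : ℝ)) ^ (K - n))⁻¹ * (c35 * (((ℓ + 1 : ℕ) : ℝ) * (((ℓ + 1) ^ a' : ℕ) : ℝ)) * α₀) * Real.exp (((((ℓ + 1 : ℕ) : ℝ)) ^ (K - n))⁻¹ * (c35 * (((ℓ + 1 : ℕ) : ℝ) * (((ℓ + 1) ^ a' : ℕ) : ℝ)) * α₀)) := by positivity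
  have ha₁ : 0 ≤ ((((ℓ + 1 : ℕ) : ℝ)) ^ (K - n))⁻¹ * (((((ℓ + 1 : ℕ) : ℝ)) ^ (K - n))⁻¹ * (c35 * (((ℓ + 1 : ℕ) : ℝ) * (((ℓ + 1) ^ a' : ℕ) : ℝ)) * α₀)) * Real.exp (((((ℓ + 1 : ℕ) : ℝ)) ^ (K - n))⁻¹ * (c35 * (((ℓ + 1 : ℕ) : ℝ) * (((ℓ + 1) ^ a' : ℕ) : ℝ)) * α₀)) := by positivity
  have hmain := exists_smoothUntwistedChart_kUniform_T3 (⟨ℓ + 1, hL, m, hm⟩ : T3Family) h hk1 he W A₀ hA0 hs hs0 u hXu hσ hσ0 hσc Fr hFr hFr1 ha₀ ha₁ hc₀ hc₁ hA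
  simpa using hmain

end Member

end Summit.QuantumFields.YangMills.Theorems.Prop7SmoothUntwistKUniform

end
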